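import Summits.QuantumFields.YangMills.Theorems.BalabanLadderROTDefs
import Summits.QuantumFields.YangMills.Theorems.LangevinControlUVOSLegsFromFemtoAndGapStubHypercubicTimeReflection
import Summits.QuantumFields.YangMills.Theorems.LangevinControlUVOSLegsFromFemtoAndGapStubHypercubicSignedPerm
import Summits.QuantumFields.YangMills.Theorems.LangevinControlUVOSLegsFromFemtoAndGapStubAssemblyPlaneStringsDefect
import HarnessLib

/-!
# Route `CheckerboardTriality` (rung R2d `BalabanLadder.ROT`), crux `TrialityLimit` (stmt-QuantumFields-22566) —
# **THE W(B₄) RUNG OF K1: off-diagonal limit points of the legs are hyperoctahedrally invariant under `MomentBounds6`**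

Helper file (`--supports stmt-QuantumFields-22566 --as helper`; planner ym-idea-1 g8's FREE-HANDS TASK (T1)+(T2),
2026-08-28T16:36:53Z; free-hands width seat `ym3-torus-px19` g0).  Definition-free, 0 sorry, standard axioms.  No item is
closed; no summit, no crux and no mass gap is proved by this file.

THE TASK AND ITS HONEST READING.  K1 = `TrialityLimit` asks that every off-diagonal limit point `S₁` of the `a⁻⁴`-renormalised
`tr F²` distributions along an admissible leg scheme (`OffDiagLimitAlong r sch φ S₁`, under `MomentBounds6 G r a`) be invariant on
King's class under every linear isometry of `ℝ⁴` preserving the checkerboard lattice `D₄` (`Aut(D₄) = W(F₄)`).  Its free part is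
the hyperoctahedral subgroup `W(B₄) ⊂ W(F₄)` (signed permutations of the axes, order 384; they preserve `D₄`, §4).  (T1) as worded
(«`W(σx₁,…,σxₙ) = W(x₁,…,xₙ)` for every signed permutation `σ`, hence `latticeDist … (linActMulti R_σ F) = latticeDist … F`»)
holds EXACTLY for the PERMUTATION half — in the tree since toolkit XXIII (✓`torusMoment_dens_permSites`,
✓`latticeDist_linActMulti_coordPerm`) — but NOT for the reflection half: the curvature composite `r.curvature.F = Σ_{i<j} P^{ij}_0`
is CORNER-based, and a lattice reflection of the axis `μ` sends it to `Σ_{p ∌ μ} P^p_{θx} + Σ_{p ∋ μ} P^p_{θx − e_μ}` (tree: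
`HypercubicLimit.Negative.torusDensity_timeReflect`, `reflDensity_sub_torusDensity`; `…DlrCollarTransfer` §3 comment), so the
torus moments of the composite are reflection-invariant only up to orientation-dependent unit shifts of the arguments — an
`O(a_k)` defect on Schwartz test functions, not an identity.  What IS true, and is what K1 needs, is (T2): the defect dies in the
limit.  THIS FILE proves (T2) for bare leg-scheme limit points under `MomentBounds6` (the tree had it only for SOFT BUNDLES, whose
export list carries the shift-defect clause: ✓`DlrCollarTransfer.stub_hypercubic`):
* §1 `thetaMulti_sub_tendsto_zero_of_momentBounds6` — along any admissible scheme, for `n ≥ 2` and `F ∈ ⁰𝒮ₙ`, the difference of the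
  centred density distributions of `ΘF` and `F` tends to `0` (toolkit XXIV-a ✓`norm_latticeDist_dens_thetaMulti_sub_le` fed with
  the shift-defect bound that toolkit XIV-b ✓`exists_planeString_bounds` extracts from `MomentBounds6` ONCE, in the regime
  `β_k ≥ β₄`, `a_k ≤ ℓ₄` reached eventually because `β_k → ∞` and `a → 0`);
* §2 `thetaMulti_invariant_of_offDiagLimitAlong`, `coordPerm_invariant_of_offDiagLimitAlong` — every off-diagonal limit point along a
  subsequence is invariant on `⁰𝒮` under the time reflection (uniqueness of limits) and under every coordinate permutation (exact);
* §3 ★ `signedPerm_invariant_of_offDiagLimitAlong` — hence under every signed permutation of the axes (toolkit XXIV-b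
  ✓`invariant_linActMulti_of_signedPerm`: `R = D⁻¹ ∘ P_σ`, axis flips are `P_{(0 i)} Θ P_{(0 i)}`); stated in `TrialityLimit`'s
  quantifier prefix with `IsSignedPerm R` in place of `D₄`-preservation and for ALL of `⁰𝒮ₙ` (no King class, no `r₀` needed) —
  `trialityLimit_rung_signedPerm`;
* §4 `signedPerm_preserves_D4` — signed permutations map the checkerboard lattice into itself (so §3 is literally the `W(B₄)`
  sub-case of K1's conclusion, and the OPEN content of K1 is exactly the index-3 coset `W(F₄) ∖ W(B₄) ∋ R₃`).

References: K. Osterwalder, R. Schrader, CMP 31 (1973) §2; J. Glimm, A. Jaffe, Quantum Physics (1987) §6.1; K. Wilson, PRD 10 (1974);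
J. H. Conway, N. J. A. Sloane, SPLAG (1999) Ch. 4 §7.1 (`Aut(D₄)`).
-/

set_option autoImplicit false

noncomputable section

open scoped SchwartzMap BigOperators
open MeasureTheory Filter Topology
open Literature.MathematicalPhysics.QuantumFieldTheory Literature.MathematicalPhysics.QuantumLattice
open Literature.MathematicalPhysics.AQFT
open Literature.Probability.LatticeModels (Site)
open Summit.QuantumFields.YangMills.Cruxes.OSLegsFromFemtoAndGap.DlrCollarTransfer (MomentBounds6 exists_abs_plane_le)
open Summit.QuantumFields.YangMills.Cruxes.OSLegsAtWeakCouplingC.Sketch (IsSignedPerm)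
open Summit.QuantumFields.YangMills.Theorems.OSLegsFromFemtoAndGap
  (latticeDist coordPerm latticeDist_linActMulti_coordPerm invariant_linActMulti_of_signedPerm exists_planeString_bounds
   norm_latticeDist_dens_thetaMulti_sub_le)
open Summit.QuantumFields.YangMills.Theorems.ROT (IsLegScheme OffDiagLimitAlong)
open Summit.QuantumFields.YangMills.Theorems.NPointIsotropy.Negative (E4)

namespace Summit.QuantumFields.YangMills.Theorems.CheckerboardTrialityHyperoctahedral

variable {G : Type} [Group G] [TopologicalSpace G] [IsTopologicalGroup G] [CompactSpace G]
  [MeasurableSpace G] [BorelSpace G]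

/-! ## §1 The time-reflection defect of the centred density distributions dies along any admissible scheme -/

/-- **The `O(a_k)` time-reflection defect tends to zero along an admissible scheme under `MomentBounds6`.**  For `n ≥ 2` and
`F ∈ ⁰𝒮ₙ`, `latticeDist_k (ΘF) − latticeDist_k F → 0` along every subsequence `φ → ∞` of a scheme with `a_k = a(β_k)`,
`β_k → ∞` and the torus ranges `a_k ≤ 1/24`, `14 ≤ L_k`, `a_k⁻² ≤ L_k` (`IsLegScheme a sch`), for a positive unit map `a → 0`.
Toolkit XIV-b gives the shift-defect bound from `MomentBounds6` once `β_k ≥ β₄` and `a_k ≤ ℓ₄`; toolkit XXIV-a turns it into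
`‖…‖ ≤ B(F)·a_k`. [cite: OS1973, §2] [cite: GlimmJaffe1987, §6.1] -/
theorem thetaMulti_sub_tendsto_zero_of_momentBounds6 (r : LatticeRep G) {a : ℝ → ℝ} (hapos : ∀ β, 0 < a β)
    (ha0 : Tendsto a atTop (𝓝 0)) (hMB : MomentBounds6 G r a) {sch : SpeciesScheme (YMSpecies G)} (hsch : IsLegScheme a sch)
    {φ : ℕ → ℕ} (hφ : Tendsto φ atTop atTop) {n : ℕ} (hn : 2 ≤ n) (F : 𝓢((Fin n → E4), ℂ)) (hF : IsOffDiagonal F) :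
    Tendsto (fun j => latticeDist r.ρ (sch.β (φ j)) (sch.L (φ j)) (sch.a (φ j)) r.curvature.F
        (wilsonTorusMean r.ρ (sch.β (φ j)) (sch.L (φ j)) r.curvature.F) n (thetaMulti 4 F) -
      latticeDist r.ρ (sch.β (φ j)) (sch.L (φ j)) (sch.a (φ j)) r.curvature.F
        (wilsonTorusMean r.ρ (sch.β (φ j)) (sch.L (φ j)) r.curvature.F) n F) atTop (𝓝 0) := by
  obtain ⟨hunits, hβ, hranges⟩ := hsch
  obtain ⟨β₄, ℓ₄, K, hℓ₄, hK, H⟩ := exists_planeString_bounds r hMB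
  obtain ⟨Cp, hCp⟩ := exists_abs_plane_le (G := G) r
  -- the constant of the `O(a)` bound
  set B : ℝ := 6 ^ n * (2 * 3 ^ (4 * n) * 2 ^ (8 * n + 1) * (Cp + Cp) ^ n *
      SchwartzMap.seminorm ℂ (8 * n + 1) 0 F +
    2 * K ^ n * (SchwartzMap.seminorm ℂ 0 (4 * n + 1) F + SchwartzMap.seminorm ℂ (6 * n) (4 * n + 1) F +
      SchwartzMap.seminorm ℂ 0 1 F + SchwartzMap.seminorm ℂ (6 * n) 1 F +
      SchwartzMap.seminorm ℂ (10 * n) 1 F)) with hBdef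
  -- the scheme along `φ`: `β → ∞`, `a → 0`
  have hβφ : Tendsto (fun j => sch.β (φ j)) atTop atTop := hβ.comp hφ
  have haφ : Tendsto (fun j => sch.a (φ j)) atTop (𝓝 0) := by
    have h : Tendsto (fun j => a (sch.β (φ j))) atTop (𝓝 0) := ha0.comp hβφ
    refine h.congr fun j => ?_
    rw [hunits]
  have hev : ∀ᶠ j in atTop, ‖latticeDist r.ρ (sch.β (φ j)) (sch.L (φ j)) (sch.a (φ j)) r.curvature.F
        (wilsonTorusMean r.ρ (sch.β (φ j)) (sch.L (φ j)) r.curvature.F) n (thetaMulti 4 F) -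
      latticeDist r.ρ (sch.β (φ j)) (sch.L (φ j)) (sch.a (φ j)) r.curvature.F
        (wilsonTorusMean r.ρ (sch.β (φ j)) (sch.L (φ j)) r.curvature.F) n F‖ ≤ B * sch.a (φ j) := by
    filter_upwards [hβφ.eventually (eventually_ge_atTop β₄), haφ.eventually (eventually_le_nhds hℓ₄)] with j hjβ hjℓ
    obtain ⟨-, ha24, hL14, hLa⟩ := hranges (φ j)
    have hapos' : 0 < sch.a (φ j) := by rw [hunits]; exact hapos _
    -- the shift-defect clause at this lattice, from `MomentBounds6`
    have hunits' : sch.a (φ j) = a (sch.β (φ j)) := hunits _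
    have hdef := fun (q : Fin n → Fin 4 × Fin 4) (hq : ∀ i, (q i).1 < (q i).2)
        (F' : 𝓢((Fin n → E4), ℂ)) (hF' : IsOffDiagonal F') =>
      (H (sch.β (φ j)) hjβ (hunits' ▸ hapos') (hunits' ▸ ha24) (hunits' ▸ hjℓ) (sch.L (φ j)) hL14 (hunits' ▸ hLa)
        n hn q hq F' hF').2
    have h := norm_latticeDist_dens_thetaMulti_sub_le r (sch.β (φ j)) (sch.L (φ j)) hapos' (by omega) hLa hK hCp
      (fun q hq F' hF' c hc => by
        have h' := hdef q hq F' hF' c (fun l => by rw [← hunits']; exact hc l)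
        simpa only [← hunits'] using h') F hF
    rw [hBdef, mul_assoc]
    exact h
  refine squeeze_zero_norm' hev ?_
  simpa using haφ.const_mul B

/-! ## §2 Off-diagonal limit points: the time reflection and the coordinate permutations -/

/-- **Every off-diagonal limit point along a leg scheme is invariant under the time reflection `Θ` on `⁰𝒮`** (under `MomentBounds6`):
`S₁ n (ΘF) = S₁ n F`.  Arity `0` is trivial (`Θ` acts as the identity), arity `1` vanishes (`S₁ 1 = 0`), and for `n ≥ 2` the
distributions of `ΘF ∈ ⁰𝒮` converge to `S₁ n (ΘF)` while differing from those of `F` by `o(1)` (§1). [cite: OS1973, §2 (2.4)] -/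
theorem thetaMulti_invariant_of_offDiagLimitAlong (r : LatticeRep G) {a : ℝ → ℝ} (hapos : ∀ β, 0 < a β)
    (ha0 : Tendsto a atTop (𝓝 0)) (hMB : MomentBounds6 G r a) {sch : SpeciesScheme (YMSpecies G)} (hsch : IsLegScheme a sch)
    {φ : ℕ → ℕ} (hφ : Tendsto φ atTop atTop) {S₁ : SchwingerFamily E4} (hS₁ : OffDiagLimitAlong r sch φ S₁)
    (n : ℕ) (F : 𝓢((Fin n → E4), ℂ)) (hF : IsOffDiagonal F) : S₁ n (thetaMulti 4 F) = S₁ n F := by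
  obtain ⟨h1, -, hconv⟩ := hS₁
  rcases Nat.lt_or_ge n 2 with hlt | hn
  · interval_cases n
    · rw [show thetaMulti 4 F = F from (by ext x; rw [thetaMulti_apply]; congr 1; exact Subsingleton.elim _ _)]
    · rw [h1, h1]
  · have hdiff := thetaMulti_sub_tendsto_zero_of_momentBounds6 r hapos ha0 hMB hsch hφ hn F hF
    have hlimΘ : Tendsto (fun j => latticeDist r.ρ (sch.β (φ j)) (sch.L (φ j)) (sch.a (φ j)) r.curvature.F
        (wilsonTorusMean r.ρ (sch.β (φ j)) (sch.L (φ j)) r.curvature.F) n (thetaMulti 4 F)) atTop (𝓝 (S₁ n F)) := by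
      have h := (hconv n hn F hF).add hdiff
      simp only [add_zero, add_sub_cancel] at h
      exact h
    exact tendsto_nhds_unique (hconv n hn (thetaMulti 4 F) (hF.linActMulti (timeReflection 4))) hlimΘ

/-- **Every off-diagonal limit point along a leg scheme is invariant under the coordinate permutations on `⁰𝒮`** — EXACT at every
lattice (✓`latticeDist_linActMulti_coordPerm`, toolkit XXIII: the torus Wilson state is invariant under `configPerm π`, the six planes
are permuted, the box is permutation invariant), so the limits agree; no moment bounds needed. [cite: Wilson1974] [cite: GlimmJaffe1987, §6.1] -/
theorem coordPerm_invariant_of_offDiagLimitAlong (r : LatticeRep G) {sch : SpeciesScheme (YMSpecies G)} {φ : ℕ → ℕ}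
    {S₁ : SchwingerFamily E4} (hS₁ : OffDiagLimitAlong r sch φ S₁) (π : Equiv.Perm (Fin 4))
    (n : ℕ) (F : 𝓢((Fin n → E4), ℂ)) (hF : IsOffDiagonal F) : S₁ n (linActMulti (coordPerm π) F) = S₁ n F := by
  obtain ⟨h1, -, hconv⟩ := hS₁
  rcases Nat.lt_or_ge n 2 with hlt | hn
  · interval_cases n
    · rw [show linActMulti (coordPerm π) F = F from (by ext x; rw [linActMulti_apply]; congr 1; exact Subsingleton.elim _ _)]
    · rw [h1, h1]
  · refine tendsto_nhds_unique (hconv n hn _ (hF.linActMulti _)) ?_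
    simp_rw [latticeDist_linActMulti_coordPerm]
    exact hconv n hn F hF

/-! ## §3 ★ The W(B₄) rung: signed permutations of the axes -/

/-- ★ **THE W(B₄) RUNG OF K1.**  Under `MomentBounds6 G r a` (positive unit map `a → 0`), along every admissible leg scheme and every
subsequence `φ → ∞`, every off-diagonal limit point `S₁` (`OffDiagLimitAlong r sch φ S₁`) is invariant on `⁰𝒮` under every signed
permutation of the coordinate axes: `S₁ n (linActMulti R F) = S₁ n F` for `R eᵢ = ±e_{σ i}` — permutations exactly (§2), the time
reflection through the `O(a_k)` defect (§1–§2), and `R = D⁻¹ ∘ P_σ` with every axis flip `P_{(0 i)} Θ P_{(0 i)}` (toolkit XXIV-b).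
[cite: OS1973, §2] [cite: GlimmJaffe1987, §6.1] -/
theorem signedPerm_invariant_of_offDiagLimitAlong (r : LatticeRep G) {a : ℝ → ℝ} (hapos : ∀ β, 0 < a β)
    (ha0 : Tendsto a atTop (𝓝 0)) (hMB : MomentBounds6 G r a) {sch : SpeciesScheme (YMSpecies G)} (hsch : IsLegScheme a sch)
    {φ : ℕ → ℕ} (hφ : Tendsto φ atTop atTop) {S₁ : SchwingerFamily E4} (hS₁ : OffDiagLimitAlong r sch φ S₁)
    (R : E4 ≃ₗᵢ[ℝ] E4) (hR : IsSignedPerm R) (n : ℕ) (F : 𝓢((Fin n → E4), ℂ)) (hF : IsOffDiagonal F) :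
    S₁ n (linActMulti R F) = S₁ n F :=
  invariant_linActMulti_of_signedPerm (fun π n F hF => coordPerm_invariant_of_offDiagLimitAlong r hS₁ π n F hF)
    (fun n F hF => thetaMulti_invariant_of_offDiagLimitAlong r hapos ha0 hMB hsch hφ hS₁ n F hF) R hR n F hF

/-- **The rung in K1's quantifier prefix** (`TrialityLimit`'s letters with `IsSignedPerm R` in place of `D₄`-preservation; valid for
ALL off-diagonal test functions, in particular on King's class at any radius). [cite: OS1973, §2] [cite: ConwaySloane1999, Ch. 4 §7.1] -/
theorem trialityLimit_rung_signedPerm :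
    ∀ (G : Type) [Group G] [TopologicalSpace G] [IsTopologicalGroup G] [CompactSpace G], IsCompactSimpleLieGroup G →
      letI : MeasurableSpace G := borel G; haveI : BorelSpace G := ⟨rfl⟩;
      ∀ (r : LatticeRep G) (a : ℝ → ℝ), (∀ β, 0 < a β) → Tendsto a atTop (nhds 0) → MomentBounds6 G r a →
        ∀ sch : SpeciesScheme (YMSpecies G), IsLegScheme a sch → ∀ φ : ℕ → ℕ, Tendsto φ atTop atTop →
          ∀ S₁ : SchwingerFamily E4, OffDiagLimitAlong r sch φ S₁ → ∀ (n : ℕ) (F : 𝓢((Fin n → E4), ℂ)), IsOffDiagonal F →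
            ∀ R : E4 ≃ₗᵢ[ℝ] E4, IsSignedPerm R → S₁ n (linActMulti R F) = S₁ n F := by
  intro G _ _ _ _ _
  letI : MeasurableSpace G := borel G
  haveI : BorelSpace G := ⟨rfl⟩
  intro r a hapos ha0 hMB sch hsch φ hφ S₁ hS₁ n F hF R hR
  exact signedPerm_invariant_of_offDiagLimitAlong r hapos ha0 hMB hsch hφ hS₁ R hR n F hF

/-! ## §4 Signed permutations preserve the checkerboard lattice `D₄` -/

omit [Group G] [TopologicalSpace G] [IsTopologicalGroup G] [CompactSpace G] [MeasurableSpace G] [BorelSpace G] in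
/-- `siteToE z = Σᵢ zᵢ • eᵢ`. [folklore] -/
theorem siteToE_eq_sum_single (z : Fin 4 → ℤ) :
    siteToE z = ∑ i : Fin 4, ((z i : ℝ)) • (EuclideanSpace.single i (1 : ℝ) : E4) := by
  conv_lhs => rw [← (EuclideanSpace.basisFun (Fin 4) ℝ).sum_repr (siteToE z)]
  refine Finset.sum_congr rfl fun i _ => ?_
  rw [EuclideanSpace.basisFun_repr, EuclideanSpace.basisFun_apply, siteToE_apply]

omit [Group G] [TopologicalSpace G] [IsTopologicalGroup G] [CompactSpace G] [MeasurableSpace G] [BorelSpace G] in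
/-- **Signed permutations of the axes map the checkerboard lattice `D₄ = {z ∈ ℤ⁴ : Σ zᵢ even}` into itself** (indeed into `ℤ⁴`,
preserving the parity of the coordinate sum): for `R eᵢ = sᵢ e_{σ i}`, `sᵢ = ±1`, `R(Σ zᵢeᵢ) = Σⱼ wⱼ eⱼ` with `wⱼ = Σ_{σ i = j} sᵢzᵢ`
and `Σ wⱼ = Σ sᵢzᵢ ≡ Σ zᵢ (mod 2)`.  So §3 is literally the `W(B₄)` sub-case of K1's conclusion (`TrialityLimit` quantifies over the
`D₄`-preserving isometries `Aut(D₄) = W(F₄) ⊋ W(B₄)`). [cite: ConwaySloane1999, Ch. 4 §7.1] -/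
theorem signedPerm_preserves_D4 (R : E4 ≃ₗᵢ[ℝ] E4) (hR : IsSignedPerm R) (z : Fin 4 → ℤ) (hz : Even (∑ i, z i)) :
    ∃ w : Fin 4 → ℤ, Even (∑ i, w i) ∧ R (siteToE z) = siteToE w := by
  classical
  choose σ hσ using hR
  -- the signs
  set s : Fin 4 → ℤ := fun i => if R (EuclideanSpace.single i 1) = EuclideanSpace.single (σ i) 1 then 1 else -1 with hs
  have hRs : ∀ i : Fin 4, R (EuclideanSpace.single i 1) = ((s i : ℤ) : ℝ) • (EuclideanSpace.single (σ i) (1 : ℝ) : E4) := by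
    intro i
    by_cases h : R (EuclideanSpace.single i 1) = EuclideanSpace.single (σ i) 1
    · simp only [hs, h, if_true, Int.cast_one, one_smul]
    · rcases hσ i with h' | h'
      · exact absurd h' h
      · simp only [hs, h, if_false, Int.cast_neg, Int.cast_one, neg_smul, one_smul]
        exact h'
  have hs1 : ∀ i, Even (1 - s i) := by
    intro i
    by_cases h : R (EuclideanSpace.single i 1) = EuclideanSpace.single (σ i) 1
    · simp only [hs, h, if_true, sub_self]
      exact ⟨0, rfl⟩
    · simp only [hs, h, if_false, sub_neg_eq_add]
      exact ⟨1, rfl⟩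
  -- the image coordinates, summed over the fibres of `σ`
  refine ⟨fun j => ∑ i ∈ Finset.univ.filter (fun i => σ i = j), s i * z i, ?_, ?_⟩
  · -- parity
    have hfib : ∑ j : Fin 4, ∑ i ∈ Finset.univ.filter (fun i => σ i = j), s i * z i = ∑ i : Fin 4, s i * z i :=
      Finset.sum_fiberwise_of_maps_to (fun i _ => Finset.mem_univ (σ i)) _
    rw [hfib]
    have hdiff : ∑ i : Fin 4, s i * z i = ∑ i : Fin 4, z i - ∑ i : Fin 4, (1 - s i) * z i := by
      rw [← Finset.sum_sub_distrib]
      refine Finset.sum_congr rfl fun i _ => by ring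
    rw [hdiff]
    exact hz.sub (Finset.even_sum _ fun i _ => (hs1 i).mul_right _)
  · -- the vector identity
    rw [siteToE_eq_sum_single z, map_sum]
    simp_rw [LinearIsometryEquiv.map_smul, hRs, smul_smul]
    rw [siteToE_eq_sum_single]
    rw [← Finset.sum_fiberwise_of_maps_to (s := (Finset.univ : Finset (Fin 4))) (t := (Finset.univ : Finset (Fin 4)))
      (g := σ) (fun i _ => Finset.mem_univ (σ i))
      (fun i => ((z i : ℝ) * ((s i : ℤ) : ℝ)) • (EuclideanSpace.single (σ i) (1 : ℝ) : E4))]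
    refine Finset.sum_congr rfl fun j _ => ?_
    rw [Int.cast_sum, Finset.sum_smul]
    refine Finset.sum_congr rfl fun i hi => ?_
    rw [(Finset.mem_filter.1 hi).2]
    push_cast
    ring_nf

end Summit.QuantumFields.YangMills.Theorems.CheckerboardTrialityHyperoctahedral

end
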